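import Literature.AlgebraicGeometry.HodgeTheory.HyperplaneSectionGysinInjective
import Literature.AlgebraicGeometry.HodgeTheory.BertiniSmoothHyperplaneSection
import Literature.AlgebraicGeometry.HodgeTheory.ComplexOrientationCycleClassFacts
import Literature.AlgebraicGeometry.HodgeTheory.AlgebraicClassesGysinOneSpan
import Literature.AlgebraicGeometry.Motives.UniversalHyperplaneSectionFibreSection
import Literature.AlgebraicGeometry.Surfaces.K3LatticeInvariantsProofs
import HarnessLib

/-!
# The class of a smooth hyperplane section is a polarisation class

Family `hodge`, layer `Literature/AlgebraicGeometry/HodgeTheory`. Theorems only (no definitions, no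
named facts, D-0026).

Let `X` be a smooth projective complex variety of dimension `m + 1` with a projective embedding
`e : X ↪ ℙᴺ`, and let `[a] ∈ (ℙᴺ)^*(ℂ)` be a hyperplane `H_a = V₊(Σ aᵢ xᵢ)` whose section
`Y_a = X ∩ H_a` — in the tree, the fibre `π⁻¹[a]` of the universal hyperplane section
`π : 𝒳 ⟶ (ℙᴺ)^*` (`Motives/UniversalHyperplaneSection`, `Motives/UniversalHyperplaneSectionFibreSection`)
with its closed immersion `u_a : π⁻¹[a] ⟶ 𝒳 ⟶ X` — is smooth projective of dimension `m`. In print: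
"`[Y_a] = c₁(𝒪_X(1)) = h` is the hyperplane class, the class of an ample line bundle, hence satisfies
hard Lefschetz" (Voisin I Thm. 6.25 with Rem. 6.27 and §7.1.2, Thm. 11.33; Voisin II §1.2.2,
§2.1.1). On the tree's carrier (`H*(X(ℂ); ℂ)`, Gysin maps of an orientation family `μ`):

* `HasHardLefschetzProperty.of_smul`, `HasHardLefschetzProperty.ne_zero` — hard Lefschetz descends
  along a non-zero scalar; a hard Lefschetz class of a positive-dimensional `X` is non-zero
  (`Lⁿ : H⁰ ≅ H²ⁿ` and `H⁰(X(ℂ); ℂ) = ℂ`);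
* `exists_embedding_compl_chart_subset_range_fiberι_toX` — a linear change of coordinates `ι'` of
  `e` and a chart index `j` with `X ∖ ι'⁻¹D₊(x_j) ⊆ u_a(π⁻¹[a])` on complex points (the universal-
  section analogue of `exists_embedding_compl_chart_subset_range` for pencils);
* `hasHardLefschetzProperty_complexGysin_one_fiberι_toX` — **`(u_a)_* 1 ∈ H²(X(ℂ); ℂ)` has the hard
  Lefschetz property in dimension `m + 1`**: the hyperplane-type class `[θ]` of `ι'` dies off
  `u_a(π⁻¹[a])` (`HodgeModel.restrictCompl_eq_zero_of_pullback_eq_fubiniStudy`), so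
  `[θ] = κ · (u_a)_* 1` by Thom–Gysin (`exists_complexGysin_eq_of_isClosedImmersion`); a non-zero
  multiple `r[θ]` is the class of a hard Lefschetz datum
  (`HodgeModel.exists_hardLefschetzNFold_of_pullback_eq_fubiniStudy_smul`), which is non-zero, so
  `κ ≠ 0` and hard Lefschetz passes from `rκ · (u_a)_* 1` to `(u_a)_* 1`;
* `isPolarizationClass_complexGysin_one_fiberι_toX` — hence, for the complex orientations,
  **`(u_a)_* 1` is a polarisation class** (`IsPolarizationClass`: rational by
  `isRationalClass_complexGysin_complexOrientationFamily`, in `N¹` by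
  `complexGysin_one_mem_algebraicClasses_codim`);
* `hasHardLefschetzProperty_complexGysin_one_fiberι_blowDown`,
  `isPolarizationClass_complexGysin_one_fiberι_blowDown` — the same for the smooth members
  `u_t : π⁻¹(t) ⟶ X̃ ⟶ X` of a pencil of hyperplane sections (`LinearSectionPencilFibres`);
* `exists_smoothHyperplaneSection_isPolarizationClass` — granted the tree's Bertini fact
  `Hartshorne1977_bertini_smoothHyperplaneSections` (a binder, not re-stated), **every smooth
  projective complex variety of dimension `m + 1 ≥ 2` contains a smooth hyperplane section
  `u : Y ⟶ X`, `dim Y = m`, a closed immersion whose class `u_* 1` is a polarisation class**;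
  `exists_smoothSurfaceSection_isPolarizationClass` is the case of threefolds (the row
  «AmpleSurfaceSectionExists» of the cell hodge-nonav's chapter ROUTE-P1U: a smooth projective
  threefold has a smooth surface `i : S ⟶ X` with `i_* 1_S` a polarisation class).

## References

* [VoisinHodgeI2002] C. Voisin, Hodge Theory and Complex Algebraic Geometry I (CUP 2002), §6.2.3
  Thm. 6.25 and Rem. 6.27, §7.1.2, §11.1.2 and Thm. 11.33 (proof).
* [VoisinHodgeII2003] C. Voisin, Hodge Theory and Complex Algebraic Geometry II (CUP 2003), §1.2.2
  Thm. 1.23, §2.1.1, §2.3.1, §3.2.2.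
* [Hartshorne1977] R. Hartshorne, Algebraic Geometry (1977), II Example 7.1.1, II Thm. 8.18,
  III Cor. 7.9.
* [HatcherAT2002] A. Hatcher, Algebraic Topology (2002), §3.3 Thm. 3.26.
-/

noncomputable section

open scoped Manifold ContDiff
open CategoryTheory CategoryTheory.Limits AlgebraicGeometry MvPolynomial
open Literature.AlgebraicTopology.SingularHomology Literature.Geometry.Kaehler
open Literature.NumberTheory.Transcendental
open Literature.AlgebraicGeometry.Motives
open Literature.AlgebraicGeometry.Motives.UniversalHyperplaneSection
open Literature.AlgebraicGeometry.Motives.AnalytificationKaehler (fubiniStudyPullbackForm)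

namespace Literature.AlgebraicGeometry.HodgeTheory

section HodgeTheory

/-! ### Hard Lefschetz classes: scalars and non-vanishing -/

section Scalars

/-- **Hard Lefschetz descends along a non-zero scalar**: if `w • κ` has the hard Lefschetz property
in dimension `m` and `w ≠ 0`, so does `κ` (`κ = w⁻¹ • (w • κ)` and `HasHardLefschetzProperty.smul`).
[cite: VoisinHodgeI2002, §6.2.3 Thm. 6.25] -/
theorem HasHardLefschetzProperty.of_smul {Y : Type*} [TopologicalSpace Y]
    {κ : singularCohomology ℂ ℂ Y 2} {m : ℕ} {w : ℂ} (h : HasHardLefschetzProperty (w • κ) m)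
    (hw : w ≠ 0) : HasHardLefschetzProperty κ m := by
  have h' := HasHardLefschetzProperty.smul h (inv_ne_zero hw)
  rwa [smul_smul, inv_mul_cancel₀ hw, one_smul] at h'

variable {n : ℕ} {X : SchemeOver ℂ}

/-- **A hard Lefschetz class of a positive-dimensional smooth projective variety is non-zero**:
`Lⁿ : H⁰(X(ℂ); ℂ) → H²ⁿ(X(ℂ); ℂ)` is bijective, `H⁰(X(ℂ); ℂ) = ℂ ≠ 0` (`X(ℂ)` is connected,
`Surfaces.finrank_complexBetti_zero`), and `Lⁿ_0 = 0` for `n ≥ 1`.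
[cite: VoisinHodgeI2002, §6.2.3 Thm. 6.25] [cite: HatcherAT2002, §3.3 Thm. 3.26] -/
theorem HasHardLefschetzProperty.ne_zero (hX : IsSmoothProjective n X) (hn : 1 ≤ n)
    {κ : complexBetti X 2} (h : HasHardLefschetzProperty κ n) : κ ≠ 0 := by
  intro h0
  have hbij := h n 0 (by omega)
  -- `Lⁿ_0 = 0` on `H⁰`
  have hzero : ∀ c : complexBetti X 0, lefschetzPow κ n 0 c = 0 := fun c ↦ by
    have h1 := lefschetzPow_smul (0 : ℂ) κ n 0 c
    rw [zero_smul, zero_pow (by omega), zero_smul] at h1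
    rw [h0]
    exact h1
  -- `H⁰(X(ℂ); ℂ)` is a line, hence non-trivial
  have hfin := Surfaces.finrank_complexBetti_zero hX
  obtain ⟨c, hc⟩ : ∃ c : complexBetti X 0, c ≠ 0 := by
    by_contra hall
    push Not at hall
    haveI : Subsingleton (complexBetti X 0) := ⟨fun x y ↦ by rw [hall x, hall y]⟩
    have h0' : Module.finrank ℂ (complexBetti X 0) = 0 := Module.finrank_zero_of_subsingleton
    omega
  exact hc (hbij.1 (by rw [hzero c, hzero 0]))

/-- Hence the hyperplane class of a hard Lefschetz datum of a positive-dimensional smooth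
projective variety is non-zero. [cite: VoisinHodgeI2002, §6.2.3 Thm. 6.25 and §7.1.2] -/
theorem HardLefschetzNFold.hyperplaneClass_ne_zero (hX : IsSmoothProjective n X) (hn : 1 ≤ n)
    (Λ : HardLefschetzNFold n X) : Λ.hyperplaneClass ≠ 0 :=
  HasHardLefschetzProperty.ne_zero hX hn Λ.hasHardLefschetz

/-- **In codimension one, a Gysin unit class is a polarisation class iff it satisfies hard
Lefschetz**: for `i : S ⟶ X` from a smooth projective `m`-fold to a smooth projective
`(m+1)`-fold, `i_* 1_S ∈ H²(X(ℂ); ℂ)` is rational (complex orientations) and lies in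
`N¹ H²(X(ℂ); ℂ)`, so only the hard Lefschetz field of `IsPolarizationClass` is at stake.
[cite: VoisinHodgeI2002, §7.3.2 and §11.1.2] [cite: Fulton1998, §19.1] -/
theorem isPolarizationClass_complexGysin_one_iff {m : ℕ} {S : SchemeOver ℂ}
    (hS : IsSmoothProjective m S) (hX : IsSmoothProjective (m + 1) X) (i : S ⟶ X) :
    IsPolarizationClass (m + 1) X
        (complexGysin complexOrientationFamily hS hX i (show 0 + 2 * (m + 1) = 2 + 2 * m by ring)
          (singularCohomology.one ℂ (ComplexPoints S))) ↔
      HasHardLefschetzProperty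
        (complexGysin complexOrientationFamily hS hX i (show 0 + 2 * (m + 1) = 2 + 2 * m by ring)
          (singularCohomology.one ℂ (ComplexPoints S))) (m + 1) :=
  ⟨fun h ↦ h.hasHardLefschetz, fun h ↦
    ⟨isRationalClass_complexGysin_complexOrientationFamily hS hX i _ (isRationalClass_one _),
      complexGysin_one_mem_algebraicClasses_codim complexOrientationFamily (p := 1) (d := m)
        (by omega) hS hX i _, h⟩⟩

end Scalars

/-! ### The hyperplane section `u_a : π⁻¹[a] ⟶ X` is a coordinate hyperplane section of a re-embedding -/

section Section

variable {m : ℕ} {X : SchemeOver ℂ} (e : ProjectiveEmbedding X) (a : Fin (e.n + 1) → ℂ) (ha : a ≠ 0)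

/-- **A re-embedding whose `j`-th coordinate hyperplane section is `X ∩ H_a`, on complex points.**
For `a ≠ 0` there are a closed immersion `ι' : X ⟶ ℙᴺ` (the embedding `e` followed by the linear
change of coordinates putting `ℓ_a = Σ aᵢ xᵢ` in the `j`-th coordinate, `a_j ≠ 0`,
`exists_linearSubst_eq`) and the chart index `j` such that every complex point of `X` outside the
chart `ι'⁻¹D₊(x_j) = e⁻¹D₊(ℓ_a)` lies in the image of `u_a : π⁻¹[a] ⟶ 𝒳 ⟶ X`: the complement is
`e⁻¹V₊(ℓ_a)` (`range_hypersurfaceSectionι`), whose complex points are those of `u_a(π⁻¹[a])`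
(`range_map_fiberι_proj_toX_eq`). [cite: Hartshorne1977, II Example 7.1.1]
[cite: VoisinHodgeII2003, §2.1.1 and §2.3.1] -/
theorem exists_embedding_compl_chart_subset_range_fiberι_toX :
    ∃ (ι' : X ⟶ projectiveSpace e.n ℂ) (_ : IsClosedImmersion ι'.left) (j : Fin (e.n + 1)),
      ∀ P : ComplexPoints X, P.pt ∉ (GeneratingSections.affineChartData ι').U j →
        P.pt ∈ Set.range (fiberι (proj e.n e.ι) (ProjectiveSpace.pointOfVec ℂ a ha) ≫
          toX e.n e.ι).left.base := by
  classical
  letI := MvPolynomial.gradedAlgebra (σ := Fin (e.n + 1)) (R := ℂ)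
  haveI : LocallyOfFiniteType X.hom := by rw [← Over.w e.ι]; infer_instance
  haveI hu := isClosedImmersion_fiberι_proj_toX_left e a ha
  -- complex points of `X ∩ V₊(ℓ_a)` are in the image of `u_a`
  have key : ∀ P : ComplexPoints X,
      P.pt ∈ Set.range (e.hypersurfaceSectionι (linForm e.n a) (isHomogeneous_linForm e.n a)).left.base →
      P.pt ∈ Set.range (fiberι (proj e.n e.ι) (ProjectiveSpace.pointOfVec ℂ a ha) ≫
        toX e.n e.ι).left.base := fun P hP ↦ by
    have h1 : P ∈ Set.range (AlgPoints.map (L := ℂ)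
        (e.hypersurfaceSectionι (linForm e.n a) (isHomogeneous_linForm e.n a))) :=
      (AlgPoints.mem_range_map_iff_pt_mem _ P).2 hP
    rw [← range_map_fiberι_proj_toX_eq e a ha] at h1
    exact (AlgPoints.mem_range_map_iff_pt_mem _ P).1 h1
  have hrange := range_hypersurfaceSectionι e (linForm e.n a) (isHomogeneous_linForm e.n a) one_pos
  -- put `ℓ_a` in the `j`-th coordinate
  obtain ⟨j, hj⟩ : ∃ j, a j ≠ 0 := Function.ne_iff.mp ha
  obtain ⟨τ, τ', hτ, hτ', hinv, hinv', hτj⟩ := exists_linearSubst_eq a j hj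
  haveI : IsIso (ProjectiveSpace.substMap τ hτ τ' hτ' hinv).left := by
    rw [ProjectiveSpace.substMap_left]
    exact isIso_substMapHom τ τ' hτ hτ' hinv hinv'
  refine ⟨e.ι ≫ ProjectiveSpace.substMap τ hτ τ' hτ' hinv, ?_, j, fun P hP ↦ key P ?_⟩
  · rw [Over.comp_left]
    infer_instance
  rw [hrange, Set.mem_preimage]
  have hℓ : linForm e.n a = τ j := by
    rw [hτj]
    rfl
  -- `P ∉ (e.ι ≫ σ_τ)⁻¹ D₊(x_j) = e⁻¹ D₊(τ_j)`
  have hP' : ¬ (e.ι.left.base P.pt ∈ Proj.basicOpen (MvPolynomial.homogeneousSubmodule (Fin (e.n + 1)) ℂ)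
      (ProjectiveSpace.substGraded τ hτ (MvPolynomial.X j))) := hP
  have hP'' : ProjectiveSpace.substGraded τ hτ (MvPolynomial.X j) ∈
      (e.ι.left.base P.pt).asHomogeneousIdeal := not_not.1 hP'
  rw [ProjectiveSpace.substGraded_apply, aeval_X] at hP''
  rw [hℓ]
  exact (ProjectiveSpectrum.mem_zeroLocus _ _ _).2 (Set.singleton_subset_iff.2 hP'')

/-! ### The class of a smooth hyperplane section satisfies hard Lefschetz -/

/-- **The Gysin unit class of a smooth hyperplane section has the hard Lefschetz property.** For
`X ⊆ ℙᴺ` smooth projective of dimension `m + 1` and `[a] ∈ (ℙᴺ)^*(ℂ)` with `π⁻¹[a] = X ∩ H_a`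
smooth projective of dimension `m`, the class `(u_a)_* 1 ∈ H²(X(ℂ); ℂ)` (any orientation family
`μ`) satisfies hard Lefschetz in dimension `m + 1`. With `ι'`, `j` as in
`exists_embedding_compl_chart_subset_range_fiberι_toX`: the hyperplane-type class `[θ]` of `ι'`
dies off the chart complement, hence off `u_a(π⁻¹[a])`
(`HodgeModel.restrictCompl_eq_zero_of_pullback_eq_fubiniStudy`, `restrictCompl_eq_zero_of_forall_pt`),
so `[θ] = κ • (u_a)_* 1` (Thom–Gysin for the smooth divisor, `exists_complexGysin_eq_of_isClosedImmersion`,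
`H⁰(π⁻¹[a](ℂ)) = ℂ · 1`); a multiple `r • [θ]`, `r ≠ 0`, is the hyperplane class of a hard Lefschetz
datum (`HodgeModel.exists_hardLefschetzNFold_of_pullback_eq_fubiniStudy_smul`), which is non-zero
(`HardLefschetzNFold.hyperplaneClass_ne_zero`), so `κ ≠ 0` and `(u_a)_* 1 = (rκ)⁻¹ •` (that class).
In print: "the class `[X ∩ H]` of a hyperplane section is `h = c₁(𝒪_X(1))`, which satisfies hard
Lefschetz". [cite: VoisinHodgeI2002, §6.2.3 Thm. 6.25, Rem. 6.27, §7.1.2 and Thm. 11.33 (proof)]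
[cite: VoisinHodgeII2003, §1.2.2 Thm. 1.23 and §2.1.1] -/
theorem hasHardLefschetzProperty_complexGysin_one_fiberι_toX (hX : IsSmoothProjective (m + 1) X)
    (hY : IsSmoothProjective m (fiberOver (proj e.n e.ι) (ProjectiveSpace.pointOfVec ℂ a ha)))
    (μ : OrientationFamily) :
    HasHardLefschetzProperty
      (complexGysin μ hY hX (fiberι (proj e.n e.ι) (ProjectiveSpace.pointOfVec ℂ a ha) ≫ toX e.n e.ι)
        (show 0 + 2 * (m + 1) = 2 + 2 * m by ring)
        (singularCohomology.one ℂ (ComplexPoints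
          (fiberOver (proj e.n e.ι) (ProjectiveSpace.pointOfVec ℂ a ha))))) (m + 1) := by
  set u := fiberι (proj e.n e.ι) (ProjectiveSpace.pointOfVec ℂ a ha) ≫ toX e.n e.ι with hudef
  haveI : LocallyOfFiniteType X.hom := by rw [← Over.w e.ι]; infer_instance
  haveI : IsClosedImmersion u.left := isClosedImmersion_fiberι_proj_toX_left e a ha
  set g : complexBetti X 2 := complexGysin μ hY hX u (show 0 + 2 * (m + 1) = 2 + 2 * m by ring)
    (singularCohomology.one ℂ (ComplexPoints
      (fiberOver (proj e.n e.ι) (ProjectiveSpace.pointOfVec ℂ a ha)))) with hgdef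
  -- the hyperplane-type class `H` of an adapted re-embedding, and its hard Lefschetz datum
  obtain ⟨ι', hι', j, hsub⟩ := exists_embedding_compl_chart_subset_range_fiberι_toX e a ha
  haveI := hι'
  obtain ⟨A⟩ := (nonempty_hodgeModel_holds (n := m + 1) (X := X)).nonempty hX
  obtain ⟨E, hE, hEm, -⟩ := exists_deRhamIsoFamily_holds A.model
  have hθ := A.fubiniStudyPullbackForm_mem_closedSmoothForms ι'
  obtain ⟨H, hH⟩ := A.pullback_surjective 2 (ofRealClass A.carrier 2 (E A.carrier 2
    (deRhamCohomology.mk ⟨fubiniStudyPullbackForm A.model ι' A.toComplexPoints, hθ⟩)))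
  obtain ⟨r, hr, hrat⟩ :=
    exists_ne_zero_smul_isRationalClass_of_pullback_eq_fubiniStudy hX A ι' E hE hθ hH
  obtain ⟨Λ, hΛ⟩ := A.exists_hardLefschetzNFold_of_pullback_eq_fubiniStudy_smul ι' E hX hE hEm hθ hH hr hrat
  -- `H` dies off `u_a(π⁻¹[a])`, hence `H = κ • g`
  have hHsupp : complexBetti.restrictCompl X (Set.range u.left.base) 2 H = 0 :=
    restrictCompl_eq_zero_of_forall_pt (fun P hP ↦ hsub P hP) 2
      (A.restrictCompl_eq_zero_of_pullback_eq_fubiniStudy ι' E hE hθ hH j)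
  obtain ⟨y, hy⟩ := exists_complexGysin_eq_of_isClosedImmersion μ hX hY u
    (show 0 + 2 * (m + 1) = 2 + 2 * m by ring) hHsupp
  obtain ⟨κ, rfl⟩ := exists_eq_smul_one μ hY y
  have hHg : H = κ • g := by rw [← hy, map_smul]
  -- the hard Lefschetz class `Λ.hyperplaneClass = (r κ) • g` is non-zero, so `κ ≠ 0`
  have hne : Λ.hyperplaneClass ≠ 0 := Λ.hyperplaneClass_ne_zero hX (by omega)
  have hκ : κ ≠ 0 := by
    rintro rfl
    exact hne (by rw [hΛ, hHg, zero_smul, smul_zero])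
  have hΛg : Λ.hyperplaneClass = (r * κ) • g := by rw [hΛ, hHg, smul_smul]
  have hL : HasHardLefschetzProperty ((r * κ) • g) (m + 1) := hΛg ▸ Λ.hasHardLefschetz
  exact HasHardLefschetzProperty.of_smul hL (mul_ne_zero hr hκ)

/-- **The class of a smooth hyperplane section is a polarisation class**: for the complex
orientations, `(u_a)_* 1 ∈ H²(X(ℂ); ℂ)` is rational, supported on a divisor and satisfies hard
Lefschetz in dimension `m + 1` — "`η = c₁(𝓛)` of an ample invertible sheaf", here `𝓛 = 𝒪_X(1)`
and `η = [X ∩ H_a]`. [cite: VoisinHodgeI2002, Thm. 6.25, Rem. 6.27, §7.1.2 and §11.1.2]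
[cite: Andre1996Motifs, §1.1 (p. 10)] -/
theorem isPolarizationClass_complexGysin_one_fiberι_toX (hX : IsSmoothProjective (m + 1) X)
    (hY : IsSmoothProjective m (fiberOver (proj e.n e.ι) (ProjectiveSpace.pointOfVec ℂ a ha))) :
    IsPolarizationClass (m + 1) X
      (complexGysin complexOrientationFamily hY hX
        (fiberι (proj e.n e.ι) (ProjectiveSpace.pointOfVec ℂ a ha) ≫ toX e.n e.ι)
        (show 0 + 2 * (m + 1) = 2 + 2 * m by ring)
        (singularCohomology.one ℂ (ComplexPoints
          (fiberOver (proj e.n e.ι) (ProjectiveSpace.pointOfVec ℂ a ha))))) :=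
  (isPolarizationClass_complexGysin_one_iff hY hX _).2
    (hasHardLefschetzProperty_complexGysin_one_fiberι_toX e a ha hX hY complexOrientationFamily)

end Section

/-! ### The smooth members of a pencil of hyperplane sections -/

section Pencil

variable {m N : ℕ} {X : SchemeOver ℂ} (ι : X ⟶ projectiveSpace N ℂ) [IsClosedImmersion ι.left]
  (a : Fin (1 + 1) → Fin (N + 1) → ℂ) (t : ComplexPoints (projectiveSpace 1 ℂ))

/-- **The class of a smooth member of a pencil of hyperplane sections satisfies hard Lefschetz**: for
`X ⊆ ℙᴺ` smooth projective of dimension `m + 1`, a pencil `a = (a₀, a₁)` of linear forms and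
`t ∈ ℙ¹(ℂ)` with smooth projective fibre `π⁻¹(t)` of dimension `m` (`LinearSectionPencilFibres`:
`u_t : π⁻¹(t) ⟶ X̃ ⟶ X`, a closed immersion onto `X ∩ H_t`), the class `(u_t)_* 1 ∈ H²(X(ℂ); ℂ)`
(any orientation family) has the hard Lefschetz property in dimension `m + 1`. Same proof as
`hasHardLefschetzProperty_complexGysin_one_fiberι_toX`, with the adapted re-embedding
`exists_embedding_compl_chart_subset_range` of `HyperplaneSectionGysinInjective` (whose main theorem,
the injectivity of `· ∪ (u_t)_* 1` below the middle degree, is the degree-wise shadow of this).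
[cite: VoisinHodgeI2002, §6.2.3 Thm. 6.25, Rem. 6.27 and §7.1.2] [cite: VoisinHodgeII2003, §2.1.1 and §2.3.1] -/
theorem hasHardLefschetzProperty_complexGysin_one_fiberι_blowDown (hX : IsSmoothProjective (m + 1) X)
    (hY : IsSmoothProjective m (fiberOver (LinearSectionNet.proj ι a) t)) (μ : OrientationFamily) :
    HasHardLefschetzProperty
      (complexGysin μ hY hX (fiberι (LinearSectionNet.proj ι a) t ≫ LinearSectionNet.blowDown ι a)
        (show 0 + 2 * (m + 1) = 2 + 2 * m by ring)
        (singularCohomology.one ℂ (ComplexPoints (fiberOver (LinearSectionNet.proj ι a) t)))) (m + 1) := by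
  obtain ⟨w, hw, rfl⟩ := ProjectiveSpace.exists_eq_pointOfVec t
  set u := fiberι (LinearSectionNet.proj ι a) (ProjectiveSpace.pointOfVec ℂ w hw) ≫
    LinearSectionNet.blowDown ι a with hudef
  haveI : IsClosedImmersion u.left := isClosedImmersion_fiberι_blowDown_left ι a _
  set g : complexBetti X 2 := complexGysin μ hY hX u (show 0 + 2 * (m + 1) = 2 + 2 * m by ring)
    (singularCohomology.one ℂ (ComplexPoints
      (fiberOver (LinearSectionNet.proj ι a) (ProjectiveSpace.pointOfVec ℂ w hw)))) with hgdef
  obtain ⟨ι', hι', j, hsub⟩ := exists_embedding_compl_chart_subset_range ι a w hw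
  haveI := hι'
  obtain ⟨A⟩ := (nonempty_hodgeModel_holds (n := m + 1) (X := X)).nonempty hX
  obtain ⟨E, hE, hEm, -⟩ := exists_deRhamIsoFamily_holds A.model
  have hθ := A.fubiniStudyPullbackForm_mem_closedSmoothForms ι'
  obtain ⟨H, hH⟩ := A.pullback_surjective 2 (ofRealClass A.carrier 2 (E A.carrier 2
    (deRhamCohomology.mk ⟨fubiniStudyPullbackForm A.model ι' A.toComplexPoints, hθ⟩)))
  obtain ⟨r, hr, hrat⟩ :=
    exists_ne_zero_smul_isRationalClass_of_pullback_eq_fubiniStudy hX A ι' E hE hθ hH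
  obtain ⟨Λ, hΛ⟩ := A.exists_hardLefschetzNFold_of_pullback_eq_fubiniStudy_smul ι' E hX hE hEm hθ hH hr hrat
  have hHsupp : complexBetti.restrictCompl X (Set.range u.left.base) 2 H = 0 :=
    restrictCompl_eq_zero_of_forall_pt (fun P hP ↦ hsub P hP) 2
      (A.restrictCompl_eq_zero_of_pullback_eq_fubiniStudy ι' E hE hθ hH j)
  obtain ⟨y, hy⟩ := exists_complexGysin_eq_of_isClosedImmersion μ hX hY u
    (show 0 + 2 * (m + 1) = 2 + 2 * m by ring) hHsupp
  obtain ⟨κ, rfl⟩ := exists_eq_smul_one μ hY y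
  have hHg : H = κ • g := by rw [← hy, map_smul]
  have hne : Λ.hyperplaneClass ≠ 0 := Λ.hyperplaneClass_ne_zero hX (by omega)
  have hκ : κ ≠ 0 := by
    rintro rfl
    exact hne (by rw [hΛ, hHg, zero_smul, smul_zero])
  have hΛg : Λ.hyperplaneClass = (r * κ) • g := by rw [hΛ, hHg, smul_smul]
  have hL : HasHardLefschetzProperty ((r * κ) • g) (m + 1) := hΛg ▸ Λ.hasHardLefschetz
  exact HasHardLefschetzProperty.of_smul hL (mul_ne_zero hr hκ)

/-- **The class of a smooth member of a pencil of hyperplane sections is a polarisation class**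
(complex orientations). [cite: VoisinHodgeI2002, Thm. 6.25, Rem. 6.27, §7.1.2 and §11.1.2]
[cite: Andre1996Motifs, §1.1 (p. 10)] -/
theorem isPolarizationClass_complexGysin_one_fiberι_blowDown (hX : IsSmoothProjective (m + 1) X)
    (hY : IsSmoothProjective m (fiberOver (LinearSectionNet.proj ι a) t)) :
    IsPolarizationClass (m + 1) X
      (complexGysin complexOrientationFamily hY hX
        (fiberι (LinearSectionNet.proj ι a) t ≫ LinearSectionNet.blowDown ι a)
        (show 0 + 2 * (m + 1) = 2 + 2 * m by ring)
        (singularCohomology.one ℂ (ComplexPoints (fiberOver (LinearSectionNet.proj ι a) t)))) :=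
  (isPolarizationClass_complexGysin_one_iff hY hX _).2
    (hasHardLefschetzProperty_complexGysin_one_fiberι_blowDown ι a t hX hY complexOrientationFamily)

end Pencil

/-! ### Existence, granted Bertini -/

section Existence

variable {m : ℕ} {X : SchemeOver ℂ}

/-- **Every smooth projective complex variety of dimension `m + 1 ≥ 2` has a smooth hyperplane
section whose class is a polarisation class**, granted Bertini's theorem in the tree's form
`Hartshorne1977_bertini_smoothHyperplaneSections`: choose a projective embedding `e`, a complex
point `[a]` of the smooth locus of the universal hyperplane section (`universalSmoothLocus_nonempty`),
and take `u = u_a : π⁻¹[a] ⟶ X` (a closed immersion, `isClosedImmersion_fiberι_proj_toX_left`) with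
`isPolarizationClass_complexGysin_one_fiberι_toX`. [cite: Hartshorne1977, II Thm. 8.18 and III Cor. 7.9]
[cite: VoisinHodgeI2002, Thm. 6.25, Rem. 6.27 and §7.1.2] -/
theorem exists_smoothHyperplaneSection_isPolarizationClass
    (hBert : Hartshorne1977_bertini_smoothHyperplaneSections) (hX : IsSmoothProjective (m + 1) X)
    (hm : 1 ≤ m) :
    ∃ (Y : SchemeOver ℂ) (hY : IsSmoothProjective m Y) (u : Y ⟶ X), IsClosedImmersion u.left ∧
      IsPolarizationClass (m + 1) X
        (complexGysin complexOrientationFamily hY hX u (show 0 + 2 * (m + 1) = 2 + 2 * m by ring)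
          (singularCohomology.one ℂ (ComplexPoints Y))) := by
  set e : ProjectiveEmbedding X := hX.isProjectiveOver.projectiveEmbedding with hedef
  haveI : LocallyOfFiniteType X.hom := by rw [← Over.w e.ι]; infer_instance
  obtain ⟨s, hs⟩ := universalSmoothLocus_nonempty e.ι hBert hX hm
  obtain ⟨a, ha, rfl⟩ := ProjectiveSpace.exists_eq_pointOfVec s
  have hY : IsSmoothProjective m (fiberOver (proj e.n e.ι) (ProjectiveSpace.pointOfVec ℂ a ha)) :=
    (mem_universalSmoothLocus_iff e.ι _).1 hs
  exact ⟨_, hY, _, isClosedImmersion_fiberι_proj_toX_left e a ha,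
    isPolarizationClass_complexGysin_one_fiberι_toX e a ha hX hY⟩

/-- **Smooth surface sections of threefolds** (the case `m = 2`): every smooth projective complex
threefold `X` has a smooth projective surface `S` with a morphism `i : S ⟶ X` (a hyperplane
section, a closed immersion) whose class `σ = i_* 1_S ∈ H²(X(ℂ); ℂ)` is a polarisation class
(`IsPolarizationClass 3 X σ`), granted Bertini. [cite: Hartshorne1977, II Thm. 8.18 and III Cor. 7.9]
[cite: VoisinHodgeI2002, Thm. 6.25, Rem. 6.27 and §7.1.2] -/
theorem exists_smoothSurfaceSection_isPolarizationClass
    (hBert : Hartshorne1977_bertini_smoothHyperplaneSections) (hX : IsSmoothProjective 3 X) :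
    ∃ (S : SchemeOver ℂ) (hS : IsSmoothProjective 2 S) (i : S ⟶ X),
      IsPolarizationClass 3 X
        (complexGysin complexOrientationFamily hS hX i (by norm_num : 0 + 2 * 3 = 2 + 2 * 2)
          (singularCohomology.one ℂ (ComplexPoints S))) := by
  obtain ⟨S, hS, i, -, hσ⟩ := exists_smoothHyperplaneSection_isPolarizationClass (m := 2) hBert hX
    (by norm_num)
  exact ⟨S, hS, i, hσ⟩

end Existence

end HodgeTheory

end Literature.AlgebraicGeometry.HodgeTheory

end
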